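import Mathlib
import HarnessLib

/-!
# Nesterenko's linear independence criterion — the Fischler–Zudilin–Chantanasiri core

Topic `Literature/NumberTheory/DiophantineApproximation`. Everything in this file is PROVED.

Nesterenko's criterion (1985) bounds from below the dimension of the `ℚ`-span of real numbers
`θ₁, …, θ_s` admitting a sequence of integer linear forms that are small but not too small.
Fischler–Zudilin (2010) found a short proof through Minkowski's convex body theorem; Chantanasiri
(2012) isolated its quantitative core, which is what this file formalises:

**Theorem** (Chantanasiri 2012, Théorème 2.1 with `t = 1` and a constant number `r + 1 ≥ 2` of
variables; Théorème 1.1). Let `ξ = (ξ_i)` be real with `ξ_{i₀} = 1`, and for `n ≥ n₀` let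
`L_n = ∑ ℓ_{i,n} X_i` be integer linear forms with `∑ |ℓ_{i,n}| ≤ Q_n`,
`0 < Λ_n := |L_n(ξ)| ≤ 1/A_n`, `Λ_{n-1} ≤ B_n Λ_n`, `B_n Q_n` non-decreasing and `A_n → ∞`.
Then `A_n < 4 (2 B_n Q_n)^r` for all large `n` (`core`; the printed constant is `2 (2 B_n Q_n)^r`,
we use an open convex body of twice the volume to apply the strict form of Minkowski's theorem,
which only changes the constant).

Proof (Chantanasiri, pp. 90–92): Minkowski gives a non-zero integer point `x` of the body
`|x₀| < 1/(2Λ_n)`, `|x₀ ξ_i − x_i| < (4Λ_n)^{1/r}`; `|x₀| → ∞` with `n`; taking `k ≤ n` least with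
`2Λ_k |x₀| ≤ 1`, the integer `∑ ℓ_{i,k} x_i = x₀ L_k(ξ) + ∑ ℓ_{i,k}(x_i − x₀ ξ_i)` forces
`|x₀| Λ_k ≤ Q_k (4Λ_n)^{1/r}`, whence the bound. The dimension statement (Nesterenko's criterion
proper) is deduced in `NesterenkoCriterion.lean`.

## References

* A. Chantanasiri, *Généralisation des critères pour l'indépendance linéaire de Nesterenko,
  Amoroso, Colmez, Fischler et Zudilin*, Ann. Math. Blaise Pascal 19 (2012) 75–105, Thm 1.1,
  Thm 2.1 and its proof pp. 90–92. [Chantanasiri2012]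
* Yu. V. Nesterenko, *On the linear independence of numbers*, Vestnik Moskov. Univ. (1985).
  [Nesterenko1985]
* S. Fischler, *Irrationalité de valeurs de zêta*, Sém. Bourbaki 910 (2002/03), Thm 2.8. [Fischler2004]
-/

noncomputable section

open Filter Set MeasureTheory Module
open scoped Topology ENNReal

namespace Literature.NumberTheory.DiophantineApproximation

namespace NesterenkoCriterion

variable {ι : Type*} [Fintype ι] [DecidableEq ι]

/-! ### The convex body and Minkowski's theorem -/

/-- **Minkowski step.** If `2^{card ι} < 2X(2ρ)^{card ι − 1}`, the open convex symmetric body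
`|x_{i₀}| < X`, `|x_{i₀} ξ_i − x_i| < ρ` (`i ≠ i₀`) — the preimage of a box of volume
`2X (2ρ)^{card ι - 1}` under the involutive shear `x ↦ (x_{i₀}, (x_{i₀} ξ_i − x_i)_{i ≠ i₀})` —
contains a non-zero integer point. [cite: Chantanasiri2012, proof of Thm 2.1 (pp. 90–91)] -/
theorem exists_int_mem_body (i₀ : ι) (ξ : ι → ℝ) {X ρ : ℝ} (hX : 0 ≤ X) (hρ : 0 ≤ ρ)
    (h : (2 : ℝ) ^ Fintype.card ι < 2 * X * (2 * ρ) ^ (Fintype.card ι - 1)) :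
    ∃ z : ι → ℤ, z ≠ 0 ∧
      (fun i => (z i : ℝ)) ∈ {x : ι → ℝ | |x i₀| < X ∧ ∀ i, i ≠ i₀ → |x i₀ * ξ i - x i| < ρ} := by
  set body : Set (ι → ℝ) := {x : ι → ℝ | |x i₀| < X ∧ ∀ i, i ≠ i₀ → |x i₀ * ξ i - x i| < ρ}
    with hbody
  -- the shear
  let T : (ι → ℝ) →ₗ[ℝ] (ι → ℝ) :=
    { toFun := fun x i => if i = i₀ then x i₀ else x i₀ * ξ i - x i
      map_add' := fun x y => by
        ext i
        simp only [Pi.add_apply]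
        split_ifs <;> ring
      map_smul' := fun c x => by
        ext i
        simp only [Pi.smul_apply, smul_eq_mul, RingHom.id_apply]
        split_ifs <;> ring }
  have hT0 : ∀ x, T x i₀ = x i₀ := fun x => by simp [T]
  have hT1 : ∀ x {i}, i ≠ i₀ → T x i = x i₀ * ξ i - x i := fun x i hi => by simp [T, hi]
  have hTT : ∀ x, T (T x) = x := by
    intro x
    ext i
    by_cases hi : i = i₀
    · subst hi; rw [hT0, hT0]
    · rw [hT1 _ hi, hT0, hT1 _ hi]; ring
  have hdet : |LinearMap.det T| = 1 := by
    have h1 : T ∘ₗ T = LinearMap.id := by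
      ext x i
      simp only [LinearMap.coe_comp, Function.comp_apply, LinearMap.id_coe, id_eq]
      rw [hTT]
    have h2 : LinearMap.det T * LinearMap.det T = 1 := by
      rw [← LinearMap.det_comp, h1, LinearMap.det_id]
    rcases mul_self_eq_one_iff.mp h2 with h3 | h3 <;> simp [h3]
  have hdet0 : LinearMap.det T ≠ 0 := by
    intro h0; rw [h0, abs_zero] at hdet; exact zero_ne_one hdet
  -- the box
  set s : ι → ℝ := fun i => if i = i₀ then X else ρ with hs
  have hpre : body = T ⁻¹' Set.pi Set.univ (fun i => Ioo (-(s i)) (s i)) := by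
    ext x
    rw [mem_preimage, Set.mem_univ_pi]
    constructor
    · rintro ⟨h0, h1⟩ i
      by_cases hi : i = i₀
      · subst hi; rw [hT0, hs]; dsimp only; rw [if_pos rfl, mem_Ioo]; exact abs_lt.mp h0
      · rw [hT1 _ hi, hs]; dsimp only; rw [if_neg hi, mem_Ioo]; exact abs_lt.mp (h1 i hi)
    · intro h'
      refine ⟨?_, fun i hi => ?_⟩
      · have := h' i₀
        rw [hT0, hs] at this; dsimp only at this; rw [if_pos rfl, mem_Ioo] at this
        exact abs_lt.mpr this
      · have := h' i
        rw [hT1 _ hi, hs] at this; dsimp only at this; rw [if_neg hi, mem_Ioo] at this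
        exact abs_lt.mpr this
  -- its volume
  have hvol : volume body = ENNReal.ofReal (2 * X * (2 * ρ) ^ (Fintype.card ι - 1)) := by
    rw [hpre, Measure.addHaar_preimage_linearMap (μ := (volume : Measure (ι → ℝ))) hdet0,
      abs_inv, hdet, inv_one, ENNReal.ofReal_one, one_mul, Real.volume_pi_Ioo]
    rw [← ENNReal.ofReal_prod_of_nonneg (fun i _ => by
      simp only [hs]; split_ifs <;> linarith)]
    congr 1
    rw [← Finset.mul_prod_erase Finset.univ _ (Finset.mem_univ i₀)]
    rw [Finset.prod_congr rfl (fun i hi => by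
        simp only [hs]; rw [if_neg (Finset.ne_of_mem_erase hi)]; ring :
        ∀ i ∈ Finset.univ.erase i₀, (s i - -s i) = 2 * ρ)]
    rw [Finset.prod_const, Finset.card_erase_of_mem (Finset.mem_univ i₀), Finset.card_univ]
    simp only [hs, if_true]; ring
  -- symmetric and convex
  have hsymm : ∀ x ∈ body, -x ∈ body := by
    rintro x ⟨h0, h1⟩
    refine ⟨by simpa using h0, fun i hi => ?_⟩
    have := h1 i hi
    simp only [Pi.neg_apply]
    rwa [show -x i₀ * ξ i - -x i = -(x i₀ * ξ i - x i) by ring, abs_neg]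
  have hconv : Convex ℝ body := by
    rw [hpre]
    exact (convex_pi fun i _ => convex_Ioo _ _).linear_preimage _
  -- Minkowski
  have hfund := ZSpan.isAddFundamentalDomain' (Pi.basisFun ℝ ι) (volume : Measure (ι → ℝ))
  have : Countable (Submodule.span ℤ (Set.range (Pi.basisFun ℝ ι))).toAddSubgroup := by
    change Countable (Submodule.span ℤ (Set.range (Pi.basisFun ℝ ι)))
    infer_instance
  have hvolF : volume (ZSpan.fundamentalDomain (Pi.basisFun ℝ ι)) = 1 := by
    rw [ZSpan.fundamentalDomain_pi_basisFun, volume_pi, Measure.pi_pi]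
    simp [Real.volume_Ico]
  have hlt : volume (ZSpan.fundamentalDomain (Pi.basisFun ℝ ι)) *
      2 ^ Module.finrank ℝ (ι → ℝ) < volume body := by
    rw [hvolF, one_mul, Module.finrank_fintype_fun_eq_card, hvol]
    have h2 : (2 : ℝ≥0∞) ^ Fintype.card ι = ENNReal.ofReal ((2 : ℝ) ^ Fintype.card ι) := by
      rw [ENNReal.ofReal_pow (by norm_num), ENNReal.ofReal_ofNat]
    rw [h2]
    exact (ENNReal.ofReal_lt_ofReal_iff (lt_of_le_of_lt (by positivity) h)).mpr h
  obtain ⟨⟨v, hv⟩, hv0, hvT⟩ :=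
    exists_ne_zero_mem_lattice_of_measure_mul_two_pow_lt_measure hfund hsymm hconv hlt
  have hvi := ((Pi.basisFun ℝ ι).mem_span_iff_repr_mem ℤ v).mp hv
  choose z hz using hvi
  have hvz : (fun i => (z i : ℝ)) = v := funext fun i => by simpa using hz i
  refine ⟨z, ?_, ?_⟩
  · rintro rfl
    apply hv0
    ext i
    simp [← hvz]
  · rw [hvz]; exact hvT

/-! ### Two elementary lemmas -/

/-- If an integer `N` equals `x + y` with `|x| ≤ 1/2` then `|x| ≤ |y|`.
[cite: Chantanasiri2012, proof of Thm 2.1 (p. 92)] -/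
theorem abs_le_abs_of_int_eq_add {N : ℤ} {x y : ℝ} (h : (N : ℝ) = x + y) (hx : |x| ≤ 1 / 2) :
    |x| ≤ |y| := by
  rcases eq_or_ne N 0 with hN | hN
  · subst hN
    have : y = -x := by simp at h; linarith
    rw [this, abs_neg]
  · have h1 : (1 : ℝ) ≤ |(N : ℝ)| := by
      rw [← Int.cast_abs]; exact_mod_cast Int.one_le_abs hN
    have h2 : |(N : ℝ)| ≤ |x| + |y| := by rw [h]; exact abs_add_le x y
    linarith

/-- `B_n Q_n` non-decreasing from `n₀` on. [folklore] -/
theorem mono_of_succ_le {f : ℕ → ℝ} {n₀ : ℕ} (h : ∀ n, n₀ ≤ n → f n ≤ f (n + 1)) {k n : ℕ}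
    (hk : n₀ ≤ k) (hkn : k ≤ n) : f k ≤ f n := by
  induction n, hkn using Nat.le_induction with
  | base => exact le_rfl
  | succ m hkm ih => exact ih.trans (h m (hk.trans hkm))

/-! ### `|x_{i₀}| → ∞` -/

omit [DecidableEq ι] in
/-- If the small forms `L_n(ξ) ≠ 0` tend to `0`, no non-zero integer multiple `y ξ` is an integer
vector; quantitatively, some `y ξ_i` stays at distance `≥ δ > 0` from `ℤ`.
[cite: Chantanasiri2012, proof of Thm 2.1 (p. 91)] -/
theorem exists_far_from_int (ξ : ι → ℝ) (ℓ : ℕ → ι → ℤ) (n₀ : ℕ)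
    (hΛ : ∀ n, n₀ ≤ n → 0 < |∑ i, (ℓ n i : ℝ) * ξ i|)
    (hΛ0 : ∀ ε : ℝ, 0 < ε → ∀ᶠ n in atTop, |∑ i, (ℓ n i : ℝ) * ξ i| < ε)
    {y : ℤ} (hy : y ≠ 0) :
    ∃ i, ∃ δ : ℝ, 0 < δ ∧ ∀ m : ℤ, δ ≤ |(y : ℝ) * ξ i - m| := by
  by_contra hcon
  push Not at hcon
  have hint : ∀ i, ∃ m : ℤ, (y : ℝ) * ξ i = m := by
    intro i
    by_contra hne
    push Not at hne
    have hδ : 0 < |(y : ℝ) * ξ i - round ((y : ℝ) * ξ i)| := by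
      rw [abs_pos, sub_ne_zero]; exact hne _
    obtain ⟨m, hm⟩ := hcon i _ hδ
    exact (not_lt.mpr (round_le ((y : ℝ) * ξ i) m)) hm
  choose m hm using hint
  have hy' : (0 : ℝ) < |(y : ℝ)| := by positivity
  obtain ⟨N, hN⟩ := eventually_atTop.mp (hΛ0 (1 / |(y : ℝ)|) (by positivity))
  have h1 := hN (max N n₀) (le_max_left _ _)
  have h2 := hΛ (max N n₀) (le_max_right _ _)
  have h3 : (y : ℝ) * ∑ i, (ℓ (max N n₀) i : ℝ) * ξ i = ((∑ i, ℓ (max N n₀) i * m i : ℤ) : ℝ) := by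
    push_cast
    rw [Finset.mul_sum]
    refine Finset.sum_congr rfl fun i _ => ?_
    rw [← hm i]; ring
  have h4 : (∑ i, ℓ (max N n₀) i * m i : ℤ) ≠ 0 := by
    intro h0
    rw [h0, Int.cast_zero, mul_eq_zero] at h3
    rcases h3 with h3 | h3
    · exact hy (by exact_mod_cast h3)
    · rw [h3, abs_zero] at h2; exact lt_irrefl _ h2
  have h5 : (1 : ℝ) ≤ |(y : ℝ)| * |∑ i, (ℓ (max N n₀) i : ℝ) * ξ i| := by
    rw [← abs_mul, h3, ← Int.cast_abs]; exact_mod_cast Int.one_le_abs h4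
  have h6 := (lt_div_iff₀' hy').mp h1
  linarith

omit [Fintype ι] [DecidableEq ι] in
/-- For every bound `Y`, eventually every integer point of the body with non-zero pivot coordinate
has `|x_{i₀}| > Y`. [cite: Chantanasiri2012, proof of Thm 2.1 (p. 91)] -/
theorem eventually_lt_abs_pivot (i₀ : ι) (ξ : ι → ℝ) (hξ : ξ i₀ = 1)
    (hfar : ∀ y : ℤ, y ≠ 0 → ∃ i, ∃ δ : ℝ, 0 < δ ∧ ∀ m : ℤ, δ ≤ |(y : ℝ) * ξ i - m|)
    (ρ : ℕ → ℝ) (hρ0 : ∀ ε : ℝ, 0 < ε → ∀ᶠ n in atTop, ρ n < ε) (Y : ℝ) :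
    ∀ᶠ n in atTop, ∀ z : ι → ℤ, z i₀ ≠ 0 →
      (∀ i, i ≠ i₀ → |(z i₀ : ℝ) * ξ i - z i| < ρ n) → Y < |(z i₀ : ℝ)| := by
  set T : Finset ℤ := Finset.Icc (-⌈Y⌉) ⌈Y⌉ with hT
  have hclaim : ∀ y ∈ T, ∀ᶠ n in atTop, y ≠ 0 → ∀ z : ι → ℤ,
      (∀ i, i ≠ i₀ → |(z i₀ : ℝ) * ξ i - z i| < ρ n) → z i₀ ≠ y := by
    intro y _
    rcases eq_or_ne y 0 with hy | hy
    · exact Eventually.of_forall fun n h => (h hy).elim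
    obtain ⟨i, δ, hδ, hδm⟩ := hfar y hy
    have hi : i ≠ i₀ := by
      rintro rfl
      have := hδm y
      rw [hξ, mul_one, sub_self, abs_zero] at this
      linarith
    filter_upwards [hρ0 δ hδ] with n hn _ z hz hzy
    have h1 := hz i hi
    rw [hzy] at h1
    have h2 := hδm (z i)
    linarith
  filter_upwards [(Filter.eventually_all_finset T).mpr hclaim] with n hn z hz0 hz
  by_contra hle
  push Not at hle
  have hmem : z i₀ ∈ T := by
    rw [hT, Finset.mem_Icc, ← abs_le]
    have h1 : |(z i₀ : ℝ)| ≤ (⌈Y⌉ : ℝ) := hle.trans (Int.le_ceil Y)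
    exact_mod_cast h1
  exact hn (z i₀) hmem hz0 z hz rfl

/-! ### The core theorem -/

/-- **Chantanasiri 2012, Théorème 2.1 (`t = 1`, constant `r`) / Théorème 1.1** — the quantitative
core of the Fischler–Zudilin proof of Nesterenko's criterion. Let `ξ : ι → ℝ` with `ξ_{i₀} = 1`,
`r = card ι − 1`, and for `n ≥ n₀` integer linear forms `L_n = ∑ ℓ_{n,i} X_i` with
`∑ |ℓ_{n,i}| ≤ Q_n`, `0 < |L_n(ξ)| ≤ 1/A_n` (`A_n > 0`, `A_n → ∞`), `|L_{n-1}(ξ)| ≤ B_n |L_n(ξ)|`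
(`n > n₀`) and `B_n Q_n ≤ B_{n+1} Q_{n+1}`. Then `A_n < 4 (2 B_n Q_n)^r` for all large `n`.
(Printed with the constant `2 (2B_nQ_n)^r`; we use the strict form of Minkowski's theorem on an
open body of twice the volume, which doubles the constant.)
[cite: Chantanasiri2012, Thm 2.1 (t = 1) and Thm 1.1] -/
theorem core (i₀ : ι) (ξ : ι → ℝ) (hξ : ξ i₀ = 1) (ℓ : ℕ → ι → ℤ) (Q A B : ℕ → ℝ) (n₀ : ℕ)
    (hQ : ∀ n, n₀ ≤ n → ∑ i, |(ℓ n i : ℝ)| ≤ Q n)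
    (hΛ : ∀ n, n₀ ≤ n → 0 < |∑ i, (ℓ n i : ℝ) * ξ i|)
    (hA : ∀ n, n₀ ≤ n → |∑ i, (ℓ n i : ℝ) * ξ i| ≤ 1 / A n)
    (hA0 : ∀ n, n₀ ≤ n → 0 < A n)
    (hB : ∀ n, n₀ < n →
      |∑ i, (ℓ (n - 1) i : ℝ) * ξ i| ≤ B n * |∑ i, (ℓ n i : ℝ) * ξ i|)
    (hBQ : ∀ n, n₀ ≤ n → B n * Q n ≤ B (n + 1) * Q (n + 1))
    (hAlim : Tendsto A atTop atTop) :
    ∀ᶠ n in atTop, A n < 4 * (2 * B n * Q n) ^ (Fintype.card ι - 1) := by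
  set Λ : ℕ → ℝ := fun n => |∑ i, (ℓ n i : ℝ) * ξ i| with hΛdef
  have hΛnn : ∀ n, 0 ≤ Λ n := fun n => abs_nonneg _
  -- `Λ_n → 0`
  have hΛ0 : ∀ ε : ℝ, 0 < ε → ∀ᶠ n in atTop, Λ n < ε := by
    intro ε hε
    filter_upwards [hAlim.eventually_gt_atTop (1 / ε), eventually_ge_atTop n₀] with n hn hn0
    have hAn := hA0 n hn0
    calc Λ n ≤ 1 / A n := hA n hn0
      _ < ε := by
        rw [div_lt_iff₀ hAn]
        exact (div_lt_iff₀' hε).mp hn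
  set r : ℕ := Fintype.card ι - 1 with hr
  rcases Nat.eq_zero_or_pos r with hr0 | hrpos
  · -- `card ι = 1`: `Λ_n = |ℓ_{n,i₀}| ≥ 1`, so `A_n ≤ 1 < 4`.
    have hsub : Subsingleton ι := Fintype.card_le_one_iff_subsingleton.mp (by omega)
    filter_upwards [eventually_ge_atTop n₀] with n hn
    rw [hr0, pow_zero, mul_one]
    have h1 : Λ n = |(ℓ n i₀ : ℝ)| := by
      simp only [hΛdef]
      rw [Fintype.sum_subsingleton _ i₀, hξ, mul_one]
    have h2 : (1 : ℝ) ≤ Λ n := by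
      have h0 := hΛ n hn
      change 0 < Λ n at h0
      rw [h1] at h0 ⊢
      have : ℓ n i₀ ≠ 0 := by
        intro h; rw [h, Int.cast_zero, abs_zero] at h0; exact lt_irrefl _ h0
      rw [← Int.cast_abs]; exact_mod_cast Int.one_le_abs this
    have h3 : Λ n ≤ 1 / A n := hA n hn
    have h4 := hA0 n hn
    have : A n ≤ 1 := by
      have := h2.trans h3
      rwa [le_div_iff₀ h4, one_mul] at this
    linarith
  -- main case `r ≥ 1`
  have hcard : Fintype.card ι = r + 1 := by omega
  set ρ : ℕ → ℝ := fun n => (4 * Λ n) ^ (1 / (r : ℝ)) with hρdef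
  have hρnn : ∀ n, 0 ≤ ρ n := fun n => Real.rpow_nonneg (by linarith [hΛnn n]) _
  have hρ_pow : ∀ n, ρ n ^ r = 4 * Λ n := by
    intro n
    simp only [hρdef]
    rw [← Real.rpow_natCast, ← Real.rpow_mul (by linarith [hΛnn n]), one_div,
      inv_mul_cancel₀ (by exact_mod_cast hrpos.ne'), Real.rpow_one]
  have hρ0 : ∀ ε : ℝ, 0 < ε → ∀ᶠ n in atTop, ρ n < ε := by
    intro ε hε
    filter_upwards [hΛ0 (ε ^ r / 4) (by positivity)] with n hn
    simp only [hρdef]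
    calc (4 * Λ n) ^ (1 / (r : ℝ)) < (ε ^ r) ^ (1 / (r : ℝ)) := by
          apply Real.rpow_lt_rpow (by linarith [hΛnn n]) (by linarith) (by positivity)
      _ = ε := by rw [one_div, Real.pow_rpow_inv_natCast hε.le hrpos.ne']
  have hfar : ∀ y : ℤ, y ≠ 0 → ∃ i, ∃ δ : ℝ, 0 < δ ∧ ∀ m : ℤ, δ ≤ |(y : ℝ) * ξ i - m| :=
    fun y hy => exists_far_from_int ξ ℓ n₀ hΛ hΛ0 hy
  have hbig := eventually_lt_abs_pivot i₀ ξ hξ hfar ρ hρ0 (1 / (2 * Λ n₀))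
  filter_upwards [eventually_gt_atTop n₀, hΛ0 (1 / 4) (by norm_num), hbig] with n hn hΛn hbign
  have hn0 : n₀ ≤ n := hn.le
  have hΛpos : 0 < Λ n := hΛ n hn0
  -- Minkowski
  have hX : (0 : ℝ) ≤ 1 / (2 * Λ n) := by positivity
  have hvol : (2 : ℝ) ^ Fintype.card ι <
      2 * (1 / (2 * Λ n)) * (2 * ρ n) ^ (Fintype.card ι - 1) := by
    rw [← hr, hcard, mul_pow, hρ_pow n]
    have : 2 * (1 / (2 * Λ n)) * (2 ^ r * (4 * Λ n)) = 2 ^ (r + 1) * 2 := by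
      field_simp; ring
    rw [this]
    linarith [pow_pos (two_pos : (0 : ℝ) < 2) (r + 1)]
  obtain ⟨z, hz0, hz1, hz2⟩ := exists_int_mem_body i₀ ξ hX (hρnn n) hvol
  dsimp only at hz1 hz2
  -- `hz1 : |z i₀| < 1 / (2 Λ n)`, `hz2 : ∀ i ≠ i₀, |z i₀ ξ i - z i| < ρ n`
  have hρ1 : ρ n < 1 := by
    by_contra hge
    push Not at hge
    have h1 : (1 : ℝ) ≤ ρ n ^ r := one_le_pow₀ hge
    rw [hρ_pow n] at h1
    linarith
  have hzi₀ : z i₀ ≠ 0 := by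
    intro h0
    apply hz0
    funext i
    by_cases hi : i = i₀
    · rw [hi, h0]; rfl
    · have h1 := hz2 i hi
      rw [h0, Int.cast_zero, zero_mul, zero_sub, abs_neg] at h1
      have h2 : |(z i : ℝ)| < 1 := h1.trans hρ1
      rw [← Int.cast_abs, ← Int.cast_one, Int.cast_lt] at h2
      exact Int.abs_lt_one_iff.mp h2
  have hY : 1 / (2 * Λ n₀) < |(z i₀ : ℝ)| := hbign z hzi₀ hz2
  -- the least `k ∈ [n₀, n]` with `2 Λ_k |z i₀| ≤ 1`
  set S : Finset ℕ := (Finset.Icc n₀ n).filter (fun k => |(z i₀ : ℝ)| * (2 * Λ k) ≤ 1) with hS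
  have hnS : n ∈ S := by
    rw [hS, Finset.mem_filter, Finset.mem_Icc]
    refine ⟨⟨hn0, le_rfl⟩, ?_⟩
    have := hz1
    rw [lt_div_iff₀ (by positivity)] at this
    exact this.le
  obtain ⟨k, hkS, hkmin⟩ : ∃ k ∈ S, ∀ k' ∈ S, k ≤ k' :=
    ⟨S.min' ⟨n, hnS⟩, Finset.min'_mem _ _, fun k' hk' => Finset.min'_le _ _ hk'⟩
  have hkS' := hkS
  rw [hS, Finset.mem_filter, Finset.mem_Icc] at hkS'
  obtain ⟨⟨hk0, hkn⟩, hkz⟩ := hkS'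
  have hΛ00 : 0 < Λ n₀ := hΛ n₀ le_rfl
  have hkn0 : n₀ < k := by
    rcases eq_or_lt_of_le hk0 with h | h
    · exfalso
      rw [← h] at hkz
      rw [div_lt_iff₀ (by positivity)] at hY
      linarith
    · exact h
  have hk1 : 1 < |(z i₀ : ℝ)| * (2 * Λ (k - 1)) := by
    by_contra hle
    push Not at hle
    have hmem : k - 1 ∈ S := by
      rw [hS, Finset.mem_filter, Finset.mem_Icc]
      exact ⟨⟨by omega, by omega⟩, hle⟩
    have := hkmin (k - 1) hmem
    omega
  have hΛk : 0 < Λ k := hΛ k hk0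
  have hBk := hB k hkn0
  change Λ (k - 1) ≤ B k * Λ k at hBk
  -- the integer `∑ ℓ_{k,i} z_i = x + y`
  set L : ℝ := ∑ i, (ℓ k i : ℝ) * ξ i with hL
  have hΛk_eq : Λ k = |L| := rfl
  set x : ℝ := (z i₀ : ℝ) * L with hx
  set y : ℝ := ∑ i, (ℓ k i : ℝ) * ((z i : ℝ) - (z i₀ : ℝ) * ξ i) with hy
  have hN : ((∑ i, ℓ k i * z i : ℤ) : ℝ) = x + y := by
    simp only [hx, hy, hL]
    push_cast
    rw [Finset.mul_sum, ← Finset.sum_add_distrib]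
    refine Finset.sum_congr rfl fun i _ => ?_
    ring
  have hxle : |x| ≤ 1 / 2 := by
    rw [hx, abs_mul, ← hΛk_eq]
    linarith
  have hyge : |x| ≤ |y| := abs_le_abs_of_int_eq_add hN hxle
  have hyle : |y| ≤ Q k * ρ n := by
    calc |y| ≤ ∑ i, |(ℓ k i : ℝ) * ((z i : ℝ) - (z i₀ : ℝ) * ξ i)| :=
          Finset.abs_sum_le_sum_abs _ _
      _ ≤ ∑ i, |(ℓ k i : ℝ)| * ρ n := by
          refine Finset.sum_le_sum fun i _ => ?_
          rw [abs_mul]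
          refine mul_le_mul_of_nonneg_left ?_ (abs_nonneg _)
          by_cases hi : i = i₀
          · rw [hi, hξ, mul_one, sub_self, abs_zero]; exact hρnn n
          · rw [abs_sub_comm]; exact (hz2 i hi).le
      _ = (∑ i, |(ℓ k i : ℝ)|) * ρ n := by rw [Finset.sum_mul]
      _ ≤ Q k * ρ n := mul_le_mul_of_nonneg_right (hQ k hk0) (hρnn n)
  have hBk0 : 0 < B k := by
    by_contra hle
    push Not at hle
    have hΛk1 : 0 < Λ (k - 1) := hΛ (k - 1) (by omega)
    nlinarith
  -- `1 < 2 B_k Q_k ρ_n ≤ 2 B_n Q_n ρ_n`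
  have hchain : 1 < 2 * (B k * Q k) * ρ n := by
    have e1 : |(z i₀ : ℝ)| * (2 * Λ (k - 1)) ≤ |(z i₀ : ℝ)| * (2 * (B k * Λ k)) :=
      mul_le_mul_of_nonneg_left (by linarith) (abs_nonneg _)
    have e2 : |(z i₀ : ℝ)| * (2 * (B k * Λ k)) = 2 * B k * |x| := by
      rw [hx, abs_mul, hΛk_eq]; ring
    have e3 : 2 * B k * |x| ≤ 2 * B k * |y| :=
      mul_le_mul_of_nonneg_left hyge (by linarith)
    have e4 : 2 * B k * |y| ≤ 2 * B k * (Q k * ρ n) :=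
      mul_le_mul_of_nonneg_left hyle (by linarith)
    linarith
  have hmono : B k * Q k ≤ B n * Q n := mono_of_succ_le (f := fun m => B m * Q m) hBQ hk0 hkn
  have hchain' : 1 < 2 * (B n * Q n) * ρ n := by nlinarith [hρnn n]
  have hpow : 1 < (2 * (B n * Q n)) ^ r * (4 * Λ n) := by
    have := one_lt_pow₀ hchain' hrpos.ne'
    rwa [mul_pow, hρ_pow n] at this
  have hAn := hA0 n hn0
  have hΛA : Λ n ≤ 1 / A n := hA n hn0
  have hpos2 : 0 < 2 * (B n * Q n) := by
    by_contra hle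
    push Not at hle
    nlinarith [hρnn n]
  have hfin : 1 < (2 * (B n * Q n)) ^ r * (4 * (1 / A n)) := by
    calc (1 : ℝ) < (2 * (B n * Q n)) ^ r * (4 * Λ n) := hpow
      _ ≤ (2 * (B n * Q n)) ^ r * (4 * (1 / A n)) := by gcongr
  rw [show (2 * (B n * Q n)) ^ r * (4 * (1 / A n)) = 4 * (2 * B n * Q n) ^ r / A n by ring,
    one_lt_div hAn] at hfin
  exact hfin

end NesterenkoCriterion

end Literature.NumberTheory.DiophantineApproximation
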